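/-
Copyright (c) 2026 the pub-hodgecm-mathlib formalisation cell (harness21).  Prover seat hodgecm-mathlib-F0P2-p01 (g13), 2026-09-01.  Road «S3-tree», brick T4′ (b):
the LEVEL-SHIFT LAW C1 `N_j(γ) = [j ≤ m₀]·N_0(γ^{(−j)})` in the T1a lattice-graph currency (the `[Valued K ℤᵐ⁰]` twin of ★ `FixedCosetsLevelShift`, which is `[ValuativeRel]`-typed).
-/
import Literature.NumberTheory.Automorphic.UnitaryLatticeTreeTypes    -- ★ T1b-2 (B-p14 (g35)): `isIntMatrix_nonsing_inv_of_v_det_eq_one`; brings ★ T1b-1 `UnitaryLatticeTreeDual` (`latt_le_latt_iff`, `latt_le_stdLattice_iff`) and ★ T1a `UnitaryLatticeTreeDefs`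
import Literature.NumberTheory.Automorphic.FixedCosetsLevelShift       -- ★ p845251 (B-p10 (g27)): the valuation-free §1 `inv_mul_levelShift_mul` ∕ `…_apply` (`g⁻¹ γ^{(c)} g = (g⁻¹γg)^{(c)}`), cited BY NAME
import Mathlib.RingTheory.LocalRing.ResidueField.Basic
import HarnessLib

/-!
# The lattice graph of a hermitian space — THE LEVEL-SHIFT LAW (road «S3-tree» T4′ (b), law C1): level-`j` fixed vertices of `γ` are the vertices
# mapped into themselves by the shifted endomorphism `γ^{(c)} = 1 + c⁻¹(γ − 1)`, `c = ϖ^j` (Kottwitz 1986 §3; Laumon, *Cohomology of Drinfeld modular varieties* I (5.3.2); Serre, *Trees* II.1)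

Topic `NumberTheory/Automorphic`; namespace `Literature.NumberTheory.Automorphic.UnitaryLatticeTree` (the T1a currency of ★ `UnitaryLatticeTreeDefs` p845270: `[Valued K ℤᵐ⁰]`,
`latt g = g·𝒪^N`, `mapGL`, `scaleLattice`, `IsIntMatrix`, `IsVertexLattice σ ϖ H d`).  THEOREMS ONLY (no definition, no instance, no notation, no named fact, no `sorry`); any `N`,
any valued field, zero `U(2,1)`-specific content.  Cell `pub/hodgecm-mathlib` (D-0151), crux H413 = `stmt-HodgeConjecture-24833`; road «S3-tree» (LEAD F0P3a-plan (g11) WORD T10-2∕T10-8 (c),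
architect A-p16 (g29) A-57 (b) «=» 15:58:47Z; deal sheet `F0/P3a/A-p16/g28/CENSUS-S3-IdentityCore.v3.A-p16g28.md` §1 row T4′ «SHIFT LAW: fixed self-dual lattices with `(γ−1)L ⊆ p^jL` = fixed
self-dual lattices of the order `𝒪_E[(γ−1)∕p^j]` ⇒ C1»; executor LAW SHEET `F0/P3/F0P3b-p01/g10/T0/T0-LAWS.md` L1 «`N_j(γ) := #{L = L^♯ : γL = L, (γ−1)L ⊆ p^j L}`», L3 «`N_j(γ) =
N_0(γ^{(−j)})` … mechanism `{L : γL = L, (γ−1)L ⊆ p^jL} = {L : 𝒪_E[(γ−1)∕p^j]·L ⊆ L}`», numerically certified by three codes on all four `H_v`-torus types).  Seat F0P2-p01 (g13).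
HONEST LABEL: HC_CM is proved only modulo the 2 remaining named inputs (hLiu418 24832, h413 24833) until rung 0 closes; nothing printed is asserted here — this is linear algebra over a
valuation ring; S3 stays a print row until the road's END lands.

WHY A SECOND FILE NEXT TO ★ `FixedCosetsLevelShift` (B-p10 (g27), p845251).  That engine is typed over `[ValuativeRel F]` with `Λ(g) = span 𝒪 (range gᵀ)` and `glInt`; the T1 tree
(A-49 currency of the road) is typed over `[Valued K ℤᵐ⁰]` with `latt g = (stdLattice K N).map g`.  The tree holds no bridge between the two integer rings, so this file RE-DERIVES the
§2–§3 dictionary of ★ `FixedCosetsLevelShift` in the T1a currency (same mathematics, ★ T1b's `latt_le_latt_iff` ∕ `isIntMatrix_nonsing_inv_of_v_det_eq_one` replacing `glInt`), and cites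
its valuation-free §1 (`inv_mul_levelShift_mul`, `inv_mul_levelShift_mul_apply`) BY NAME.

THE MATHEMATICS.  Fix `c ∈ K` with `0 < |c| < 1` (think `c = ϖ^j`, `j ≥ 1`) and `γ ∈ GL_N(K)`; the SHIFTED matrix is `γ^{(c)} := 1 + c⁻¹(γ − 1) ∈ M_N(K)`.  For a lattice
`M = latt g` (`g ∈ GL_N(K)`): «`γ` fixes `M` at level `c`» means `γ·M = M` and `(γ − 1)·M ⊆ c·M` (basis-free; in the basis `g`: `g⁻¹γg ∈ GL_N(𝒪)` and `g⁻¹γg ≡ 1 (mod c)`), and this is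
EQUIVALENT to `γ^{(c)}·M ⊆ M` (§4): `(γ − 1)M ⊆ cM ⟺ c⁻¹(γ−1)M ⊆ M ⟺ γ^{(c)}M ⊆ M` (§1, §3), while `γM = M` comes for free from `(γ−1)M ⊆ cM ⊆ ϖM` because a matrix `≡ 1 (mod 𝔪)` has
unit determinant and an integral inverse (§2).  Hence for every vertex type `d` the level-`c` fixed vertices of `γ` and the `γ^{(c)}`-stable vertices are THE SAME SET (§5), in particular
have the same cardinality — law C1 `N_j(γ) = N_0(γ^{(−j)})` in its lattice form (the right side is read off the tree by T2∕T3′∕T5 as the fixed-vertex count of a torus element with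
the shifted root valuations, A-50; when `j > m₀` both sides are empty, which is the `[j ≤ m₀]` of the law sheet).  §6: stability under `1 + X` is stability under `X`, i.e. under the order
`𝒪[X]`, `X = c⁻¹(γ − 1)` — the deal sheet's wording of T4′.

* §1 `isIntMatrix_levelShift_iff` — `IsIntMatrix (1 + c⁻¹ • (M − 1)) ↔ ∀ i k, |(M − 1)_{ik}| ≤ |c|` (`c ≠ 0`).
* §2 `v_det_eq_one_of_forall_v_sub_one_lt_one`, `isIntMatrix_of_forall_v_sub_one_lt_one`, `isIntMatrix_nonsing_inv_of_forall_v_sub_one_lt_one` — `M ≡ 1 (mod 𝔪)` ⇒ `M ∈ GL_N(𝒪)`.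
* §3 `map_sub_one_latt_le_scaleLattice_iff` (over ★ `scaleLattice_latt`) — `(γ − 1)·latt g ⊆ c·latt g ↔ g⁻¹γg ≡ 1 (mod c)`; `map_levelShift_latt_le_iff` — `γ^{(c)}·latt g ⊆ latt g ↔` the same.
* §4 `mapGL_eq_and_level_iff_map_levelShift_le` — THE SHIFT LAW in lattice language (T1a twin of ★ `map_eq_self_and_level_iff_map_levelShift_le`).
* §5 `setOf_levelFixed_vertex_eq_setOf_levelShift_stable`, `ncard_levelFixed_vertex_eq` — C1 on the vertices of each type `d` (set equality, hence count equality).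
* §6 `map_one_add_le_iff` — `(1 + X)·M ⊆ M ↔ X·M ⊆ M`.

## References
* [Kottwitz1986] R. E. Kottwitz, *Base change for unit elements of Hecke algebras*, Compositio Math. 60 (1986): §3 (fixed cosets ↔ stable lattices).
* [Laumon1995] G. Laumon, *Cohomology of Drinfeld Modular Varieties* I (1996): Lemma (5.3.2) p. 136, (4.3.11) p. 83.
* [Serre1980Trees] J.-P. Serre, *Trees* (1980): Ch. II §1.1–1.2 (lattices, the tree of `SL₂`, congruence level of a stabiliser).
* [Rogawski1990] J. Rogawski, Ann. of Math. Stud. 123 (1990): §4.9 Prop. 4.9.1 (a) p. 55 (the transfer this road pays), §12.2 (level structure at a non-split place).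
-/

set_option autoImplicit false

noncomputable section

open scoped Valued WithZero Matrix MatrixGroups

namespace Literature.NumberTheory.Automorphic.UnitaryLatticeTree

open Literature.NumberTheory.Automorphic Literature.NumberTheory.Automorphic.HermitianLattice

variable {K : Type*} [Field K] [Valued K ℤᵐ⁰] {N : ℕ}

/-! ## §1 Integrality of the shifted matrix, entrywise -/

/-- **`γ^{(c)} = 1 + c⁻¹(M − 1)` is integral iff `M ≡ 1 (mod c)` entrywise** (`c ≠ 0`): the `(i,k)` entry of the shift is `δ_{ik} + c⁻¹(M − 1)_{ik}` and `δ_{ik} ∈ 𝒪`.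
[cite: Serre1980Trees, Ch. II §1.1–1.2] [cite: Kottwitz1986, §3] -/
theorem isIntMatrix_levelShift_iff {c : K} (hc : c ≠ 0) (M : Matrix (Fin N) (Fin N) K) :
    IsIntMatrix (1 + c⁻¹ • (M - 1)) ↔ ∀ i k, Valued.v ((M - 1) i k) ≤ Valued.v c := by
  have key : ∀ x : K, Valued.v (c⁻¹ * x) ≤ 1 ↔ Valued.v x ≤ Valued.v c := fun x => by
    have hc' : Valued.v c ≠ 0 := (Valuation.ne_zero_iff _).2 hc
    rw [map_mul, map_inv₀, ← div_eq_inv_mul, div_le_one₀ (zero_lt_iff.2 hc')]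
  have hentry : ∀ i k, (1 + c⁻¹ • (M - 1)) i k = (1 : Matrix (Fin N) (Fin N) K) i k + c⁻¹ * (M - 1) i k := fun i k => by
    rw [Matrix.add_apply, Matrix.smul_apply, smul_eq_mul]
  have hone : ∀ i k, Valued.v ((1 : Matrix (Fin N) (Fin N) K) i k) ≤ 1 := fun i k => by
    rw [Matrix.one_apply]; split_ifs <;> simp
  constructor
  · intro h i k
    have h1 : Valued.v ((1 : Matrix (Fin N) (Fin N) K) i k + c⁻¹ * (M - 1) i k) ≤ 1 := by rw [← hentry]; exact h i k
    have h2 : c⁻¹ * (M - 1) i k = ((1 : Matrix (Fin N) (Fin N) K) i k + c⁻¹ * (M - 1) i k) - (1 : Matrix (Fin N) (Fin N) K) i k := by ring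
    have h3 : Valued.v (c⁻¹ * (M - 1) i k) ≤ 1 := by rw [h2]; exact Valued.v.map_sub_le h1 (hone i k)
    exact (key _).1 h3
  · intro h i k
    rw [hentry]
    exact Valued.v.map_add_le (hone i k) ((key _).2 (h i k))

/-! ## §2 A matrix congruent to `1` modulo the maximal ideal lies in `GL_N(𝒪)` -/

/-- **`M ≡ 1 (mod 𝔪)` entrywise ⇒ `|det M| = 1`** (the residue of `det M` is `det 1 = 1`). [cite: Serre1980Trees, Ch. II §1.1–1.2] -/
theorem v_det_eq_one_of_forall_v_sub_one_lt_one (M : Matrix (Fin N) (Fin N) K) (hM : ∀ i k, Valued.v ((M - 1) i k) < 1) :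
    Valued.v M.det = 1 := by
  -- lift `M − 1` to a matrix `A` over `𝒪` with entries in the maximal ideal (★ `FixedCosetsLevelShift` §2, `Valued` currency)
  set A : Matrix (Fin N) (Fin N) 𝒪[K] := fun i k => ⟨(M - 1) i k, (Valuation.mem_integer_iff _ _).2 (hM i k).le⟩ with hA
  have hMA : M = (1 + A).map (𝒪[K]).subtype := by
    ext i k
    rw [Matrix.map_apply, Matrix.add_apply, Subring.subtype_apply, Subring.coe_add, hA]
    change M i k = ((1 : Matrix (Fin N) (Fin N) 𝒪[K]) i k : K) + (M - 1) i k
    rw [Matrix.sub_apply, Matrix.one_apply, Matrix.one_apply]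
    split_ifs <;> simp
  have hres : IsLocalRing.residue 𝒪[K] (1 + A).det = 1 := by
    rw [RingHom.map_det, map_add, map_one]
    have hA0 : (IsLocalRing.residue 𝒪[K]).mapMatrix A = 0 := by
      ext i k
      rw [RingHom.mapMatrix_apply, Matrix.map_apply, Matrix.zero_apply, IsLocalRing.residue_eq_zero_iff, IsLocalRing.mem_maximalIdeal, mem_nonunits_iff,
        Valuation.Integer.not_isUnit_iff_valuation_lt_one]
      exact hM i k
    rw [hA0, add_zero, Matrix.det_one]
  have hunit : IsUnit (1 + A).det := (IsLocalRing.residue_ne_zero_iff_isUnit _).1 (by rw [hres]; exact one_ne_zero)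
  rw [hMA, ← RingHom.mapMatrix_apply, ← RingHom.map_det]
  exact Valuation.Integers.one_of_isUnit (Valuation.integer.integers Valued.v) hunit

/-- `M ≡ 1 (mod 𝔪)` entrywise ⇒ `M` is integral. [cite: Serre1980Trees, Ch. II §1.1–1.2] -/
theorem isIntMatrix_of_forall_v_sub_one_lt_one (M : Matrix (Fin N) (Fin N) K) (hM : ∀ i k, Valued.v ((M - 1) i k) < 1) : IsIntMatrix M := by
  intro i k
  have h : M i k = (1 : Matrix (Fin N) (Fin N) K) i k + (M - 1) i k := by rw [Matrix.sub_apply, add_sub_cancel]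
  have hone : Valued.v ((1 : Matrix (Fin N) (Fin N) K) i k) ≤ 1 := by rw [Matrix.one_apply]; split_ifs <;> simp
  rw [h]
  exact Valued.v.map_add_le hone (hM i k).le

/-- **`M ≡ 1 (mod 𝔪)` entrywise ⇒ `M⁻¹` is integral** (`M⁻¹ = (det M)⁻¹ · adj M`, ★ `isIntMatrix_nonsing_inv_of_v_det_eq_one`) — the «`γL = L` is automatic once `(γ − 1)L ⊆ ϖL`» half of the law.
[cite: Kottwitz1986, §3] [cite: Serre1980Trees, Ch. II §1.1–1.2] -/
theorem isIntMatrix_nonsing_inv_of_forall_v_sub_one_lt_one (M : Matrix (Fin N) (Fin N) K) (hM : ∀ i k, Valued.v ((M - 1) i k) < 1) : IsIntMatrix M⁻¹ :=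
  isIntMatrix_nonsing_inv_of_v_det_eq_one (isIntMatrix_of_forall_v_sub_one_lt_one M hM) (v_det_eq_one_of_forall_v_sub_one_lt_one M hM)

/-! ## §3 The level condition and shift-stability in a basis -/

/-- **LEVEL IN A BASIS**: for `g ∈ GL_N(K)` and `c ≠ 0`, `(γ − 1)·latt g ⊆ c·latt g ↔ |(g⁻¹γg − 1)_{ik}| ≤ |c|` for all `i, k` (i.e. `g⁻¹γg ≡ 1 (mod c)`).
[cite: Serre1980Trees, Ch. II §1.1–1.2] [cite: Kottwitz1986, §3] -/
theorem map_sub_one_latt_le_scaleLattice_iff {c : K} (hc : c ≠ 0) (γ g : GL (Fin N) K) :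
    (latt (g : Matrix (Fin N) (Fin N) K)).map ((Matrix.toLin' ((γ : Matrix (Fin N) (Fin N) K) - 1)).restrictScalars 𝒪[K]) ≤
        scaleLattice c (latt (g : Matrix (Fin N) (Fin N) K)) ↔
      ∀ i k, Valued.v ((((g⁻¹ * γ * g : GL (Fin N) K) : Matrix (Fin N) (Fin N) K) - 1) i k) ≤ Valued.v c := by
  have hg : IsUnit (g : Matrix (Fin N) (Fin N) K).det := Matrix.isUnits_det_units g
  have hcg : IsUnit (c • (g : Matrix (Fin N) (Fin N) K)).det := by
    rw [Matrix.det_smul]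
    exact (hc.isUnit.pow _).mul hg
  rw [← latt_mul, scaleLattice_latt, latt_le_latt_iff hcg]
  -- `(c•g)⁻¹ ((γ−1) g) = c⁻¹ • (g⁻¹γg − 1)`
  have hinv : (c • (g : Matrix (Fin N) (Fin N) K))⁻¹ = c⁻¹ • (g : Matrix (Fin N) (Fin N) K)⁻¹ :=
    Matrix.inv_eq_left_inv (by rw [Matrix.smul_mul, Matrix.mul_smul, smul_smul, inv_mul_cancel₀ hc, one_smul, Matrix.nonsing_inv_mul _ hg])
  have hP : (((g⁻¹ * γ * g : GL (Fin N) K) : Matrix (Fin N) (Fin N) K) - 1) =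
      (g : Matrix (Fin N) (Fin N) K)⁻¹ * (((γ : Matrix (Fin N) (Fin N) K) - 1) * (g : Matrix (Fin N) (Fin N) K)) := by
    rw [Units.val_mul, Units.val_mul, Matrix.coe_units_inv, Matrix.sub_mul, Matrix.one_mul, Matrix.mul_sub, Matrix.nonsing_inv_mul _ hg,
      Matrix.mul_assoc]
  have hmat : (c • (g : Matrix (Fin N) (Fin N) K))⁻¹ * (((γ : Matrix (Fin N) (Fin N) K) - 1) * (g : Matrix (Fin N) (Fin N) K)) =
      c⁻¹ • ((((g⁻¹ * γ * g : GL (Fin N) K) : Matrix (Fin N) (Fin N) K) - 1)) := by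
    rw [hinv, Matrix.smul_mul, hP]
  rw [hmat]
  have key : ∀ x : K, Valued.v (c⁻¹ * x) ≤ 1 ↔ Valued.v x ≤ Valued.v c := fun x => by
    have hc' : Valued.v c ≠ 0 := (Valuation.ne_zero_iff _).2 hc
    rw [map_mul, map_inv₀, ← div_eq_inv_mul, div_le_one₀ (zero_lt_iff.2 hc')]
  constructor
  · intro h i k
    have h1 := h i k
    rw [Matrix.smul_apply, smul_eq_mul] at h1
    exact (key _).1 h1
  · intro h i k
    rw [Matrix.smul_apply, smul_eq_mul]
    exact (key _).2 (h i k)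

/-- **SHIFT-STABILITY IN A BASIS**: for `g ∈ GL_N(K)` and `c ≠ 0`, `γ^{(c)}·latt g ⊆ latt g ↔ g⁻¹γ^{(c)}g = (g⁻¹γg)^{(c)}` is integral `↔ g⁻¹γg ≡ 1 (mod c)`
(★ `inv_mul_levelShift_mul`, §1). [cite: Kottwitz1986, §3] [cite: Laumon1995, Lemma (5.3.2) p. 136] -/
theorem map_levelShift_latt_le_iff {c : K} (hc : c ≠ 0) (γ g : GL (Fin N) K) :
    (latt (g : Matrix (Fin N) (Fin N) K)).map ((Matrix.toLin' (1 + c⁻¹ • ((γ : Matrix (Fin N) (Fin N) K) - 1))).restrictScalars 𝒪[K]) ≤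
        latt (g : Matrix (Fin N) (Fin N) K) ↔
      ∀ i k, Valued.v ((((g⁻¹ * γ * g : GL (Fin N) K) : Matrix (Fin N) (Fin N) K) - 1) i k) ≤ Valued.v c := by
  have hg : IsUnit (g : Matrix (Fin N) (Fin N) K).det := Matrix.isUnits_det_units g
  rw [← latt_mul, latt_le_latt_iff hg, ← Matrix.mul_assoc, ← Matrix.coe_units_inv, inv_mul_levelShift_mul c γ g]
  exact isIntMatrix_levelShift_iff hc _

/-! ## §4 THE LEVEL-SHIFT LAW in lattice language -/

/-- **THE LEVEL-SHIFT LAW** (T1a twin of ★ `FixedCosetsLevelShift.map_eq_self_and_level_iff_map_levelShift_le`): for `0 < |c| < 1`, `γ, g ∈ GL_N(K)` and `M = latt g`: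
`(γ·M = M ∧ (γ − 1)·M ⊆ c·M) ↔ γ^{(c)}·M ⊆ M` — the level-`c` fixed lattices of `γ` are exactly the lattices mapped into themselves by the shifted endomorphism; the clause `γ·M = M`
is automatic (§2). [cite: Kottwitz1986, §3] [cite: Laumon1995, Lemma (5.3.2) p. 136] [cite: Serre1980Trees, Ch. II §1.1–1.2] -/
theorem mapGL_eq_and_level_iff_map_levelShift_le {c : K} (hc : c ≠ 0) (hc1 : Valued.v c < 1) (γ g : GL (Fin N) K) :
    (mapGL γ (latt (g : Matrix (Fin N) (Fin N) K)) = latt (g : Matrix (Fin N) (Fin N) K) ∧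
        (latt (g : Matrix (Fin N) (Fin N) K)).map ((Matrix.toLin' ((γ : Matrix (Fin N) (Fin N) K) - 1)).restrictScalars 𝒪[K]) ≤
          scaleLattice c (latt (g : Matrix (Fin N) (Fin N) K))) ↔
      (latt (g : Matrix (Fin N) (Fin N) K)).map ((Matrix.toLin' (1 + c⁻¹ • ((γ : Matrix (Fin N) (Fin N) K) - 1))).restrictScalars 𝒪[K]) ≤
        latt (g : Matrix (Fin N) (Fin N) K) := by
  rw [map_levelShift_latt_le_iff hc, map_sub_one_latt_le_scaleLattice_iff hc]
  refine ⟨fun h => h.2, fun hlev => ⟨?_, hlev⟩⟩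
  -- `γ·latt g = latt g` is automatic: `P := g⁻¹γg ≡ 1 (mod c)`, `|c| < 1`, so `P` and `P⁻¹` are integral (§2)
  have hg : IsUnit (g : Matrix (Fin N) (Fin N) K).det := Matrix.isUnits_det_units g
  have hlt : ∀ i k, Valued.v ((((g⁻¹ * γ * g : GL (Fin N) K) : Matrix (Fin N) (Fin N) K) - 1) i k) < 1 := fun i k => (hlev i k).trans_lt hc1
  have hP : IsIntMatrix (((g⁻¹ * γ * g : GL (Fin N) K) : Matrix (Fin N) (Fin N) K)) := isIntMatrix_of_forall_v_sub_one_lt_one _ hlt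
  have hPi : IsIntMatrix (((g⁻¹ * γ * g : GL (Fin N) K) : Matrix (Fin N) (Fin N) K))⁻¹ := isIntMatrix_nonsing_inv_of_forall_v_sub_one_lt_one _ hlt
  rw [mapGL_latt]
  refine le_antisymm ?_ ?_
  · rw [latt_le_latt_iff hg, Units.val_mul, ← Matrix.mul_assoc]
    rwa [Units.val_mul, Units.val_mul, Matrix.coe_units_inv] at hP
  · rw [latt_le_latt_iff (Matrix.isUnits_det_units (γ * g)), ← Matrix.coe_units_inv, ← Units.val_mul]
    have e : (γ * g)⁻¹ * g = (g⁻¹ * γ * g)⁻¹ := by group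
    rw [e, Matrix.coe_units_inv]
    exact hPi

/-! ## §5 Law C1 on the vertices of the lattice graph: the level-`c` fixed vertices of `γ` ARE the `γ^{(c)}`-stable vertices, type by type -/

/-- **LAW C1, SET FORM**: for every vertex type `d` of the lattice graph of `(σ, ϖ, H)` (★ `IsVertexLattice σ ϖ H d`: `d = 0` self-dual ∕ hyperspecial, `d = 2` the second type at
`N = 3`), every `γ ∈ GL_N(K)` and `0 < |c| < 1`: `{M vertex of type d | γ·M = M ∧ (γ − 1)·M ⊆ c·M} = {M vertex of type d | γ^{(c)}·M ⊆ M}`.  With `c = ϖ^j` the left side is the law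
sheet's `N_j(γ)`-set (L1), the right side the set of vertices stable under the order `𝒪[(γ−1)∕ϖ^j]` (§6), counted on the tree as `N_0` of an element with the root valuations lowered by
`j` (T2∕T3′∕T5, A-50); for `j > m₀(γ)` both are empty. [cite: Kottwitz1986, §3] [cite: Laumon1995, Lemma (5.3.2) p. 136] [cite: Rogawski1990, §4.9 Prop. 4.9.1 (a) p. 55] -/
theorem setOf_levelFixed_vertex_eq_setOf_levelShift_stable (σ : K →+* K) (ϖ : K) (H : Matrix (Fin N) (Fin N) K) (d : ℕ)
    {c : K} (hc : c ≠ 0) (hc1 : Valued.v c < 1) (γ : GL (Fin N) K) :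
    {M : Submodule 𝒪[K] (Fin N → K) | IsVertexLattice σ ϖ H d M ∧ mapGL γ M = M ∧
        M.map ((Matrix.toLin' ((γ : Matrix (Fin N) (Fin N) K) - 1)).restrictScalars 𝒪[K]) ≤ scaleLattice c M} =
      {M : Submodule 𝒪[K] (Fin N → K) | IsVertexLattice σ ϖ H d M ∧
        M.map ((Matrix.toLin' (1 + c⁻¹ • ((γ : Matrix (Fin N) (Fin N) K) - 1))).restrictScalars 𝒪[K]) ≤ M} := by
  ext M
  simp only [Set.mem_setOf_eq]
  constructor
  · rintro ⟨hV, hfix, hlev⟩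
    obtain ⟨g, rfl, hrest⟩ := hV
    exact ⟨⟨g, rfl, hrest⟩, (mapGL_eq_and_level_iff_map_levelShift_le hc hc1 γ g).1 ⟨hfix, hlev⟩⟩
  · rintro ⟨hV, hst⟩
    obtain ⟨g, rfl, hrest⟩ := hV
    exact ⟨⟨g, rfl, hrest⟩, (mapGL_eq_and_level_iff_map_levelShift_le hc hc1 γ g).2 hst⟩

/-- **LAW C1, COUNT FORM** `N_j(γ) = N_0(γ^{(−j)})`: the number of level-`c` fixed vertices of type `d` of `γ` equals the number of `γ^{(c)}`-stable vertices of type `d`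
(`Set.ncard`; both sides `0` when infinite or empty). [cite: Kottwitz1986, §3] [cite: Laumon1995, (4.3.11) p. 83] [cite: Rogawski1990, §4.9 Prop. 4.9.1 (a) p. 55] -/
theorem ncard_levelFixed_vertex_eq (σ : K →+* K) (ϖ : K) (H : Matrix (Fin N) (Fin N) K) (d : ℕ)
    {c : K} (hc : c ≠ 0) (hc1 : Valued.v c < 1) (γ : GL (Fin N) K) :
    {M : Submodule 𝒪[K] (Fin N → K) | IsVertexLattice σ ϖ H d M ∧ mapGL γ M = M ∧
        M.map ((Matrix.toLin' ((γ : Matrix (Fin N) (Fin N) K) - 1)).restrictScalars 𝒪[K]) ≤ scaleLattice c M}.ncard =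
      {M : Submodule 𝒪[K] (Fin N → K) | IsVertexLattice σ ϖ H d M ∧
        M.map ((Matrix.toLin' (1 + c⁻¹ • ((γ : Matrix (Fin N) (Fin N) K) - 1))).restrictScalars 𝒪[K]) ≤ M}.ncard := by
  rw [setOf_levelFixed_vertex_eq_setOf_levelShift_stable σ ϖ H d hc hc1 γ]

/-! ## §6 Stability under `1 + X` is stability under `X` (the order `𝒪[(γ − 1)∕c]`) -/

/-- `(1 + X)·M ⊆ M ↔ X·M ⊆ M` for any lattice `M` and matrix `X`: shift-stability is stability under `X = c⁻¹(γ − 1)`, i.e. under the order `𝒪[X]` of the deal sheet's T4′ row.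
[cite: Laumon1995, Lemma (5.3.2) p. 136] -/
theorem map_one_add_le_iff (X : Matrix (Fin N) (Fin N) K) (M : Submodule 𝒪[K] (Fin N → K)) :
    M.map ((Matrix.toLin' (1 + X)).restrictScalars 𝒪[K]) ≤ M ↔ M.map ((Matrix.toLin' X).restrictScalars 𝒪[K]) ≤ M := by
  have happ : ∀ m : Fin N → K, ((Matrix.toLin' (1 + X)).restrictScalars 𝒪[K]) m = m + ((Matrix.toLin' X).restrictScalars 𝒪[K]) m := fun m => by
    rw [LinearMap.restrictScalars_apply, LinearMap.restrictScalars_apply, Matrix.toLin'_apply, Matrix.toLin'_apply, Matrix.add_mulVec, Matrix.one_mulVec]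
  constructor
  · intro h x hx
    obtain ⟨m, hm, rfl⟩ := Submodule.mem_map.1 hx
    have h1 : m + ((Matrix.toLin' X).restrictScalars 𝒪[K]) m ∈ M := by
      rw [← happ]; exact h (Submodule.mem_map.2 ⟨m, hm, rfl⟩)
    have h2 := M.sub_mem h1 hm
    rwa [add_sub_cancel_left] at h2
  · intro h x hx
    obtain ⟨m, hm, rfl⟩ := Submodule.mem_map.1 hx
    rw [happ]
    exact M.add_mem hm (h (Submodule.mem_map.2 ⟨m, hm, rfl⟩))

end Literature.NumberTheory.Automorphic.UnitaryLatticeTree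

end
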